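import Summits.Ventures.PercRepro.ThetaOmegaCoreBadTwoPos

/-!
# A bad edge of type T00 and a bad two-edge point touching it

Dossier proofs/MINE1-theoremS.md, Addendum 81 suppl. 2 (mine-1, gen 42). Let `(s, u = s + q)` be
a bad edge of type T00 and `r ≠ q` a bad two-edge point one of whose edges `(x, x + r)` touches
`{s, u}` in one endpoint while the other edge `(x', x' + r)` is in general position
(`c1 x' ≠ c1 x`, each K-mono or `∅`). The four positions are impossible:

* `x = s` (`touch_lower_eq_false`): `(s + q) \ (s + r) = {q}` unless `c1 (s + r) = c1 s`, and then
  the co-join mechanism with the other edge (below `s`) fires;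
* `x + r = s` (`touch_upper_eq_false`): the `q`-edge `(s \ r, s \ r + q)`, or `x = ∅` and the
  `q`-edge `(s, s + q)`;
* `x = s + q` (`touch_lower_eq_upper_false`): a `q`-edge of `C` with lower end `U \ (s + q + r)`;
* `x + r = s + q` (`touch_upper_eq_upper_false`): the `q`-edge `(s \ r, x)`.
-/

namespace PercRepro.MSTight

open Finset

variable {α : Type*} [DecidableEq α]

section Touch

variable {q r : α} {U : Finset α} {F : Finset (Finset α)} {c0 c1 : Finset α → Bool}
  {s x x' : Finset α}

/-- `q ∉ x` and `q ≠ r` give `q ∉ x + r`. -/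
theorem notMem_insert_of_ne_of_notMem (hqr : q ≠ r) (hqx : q ∉ x) : q ∉ insert r x := by
  simp only [mem_insert, not_or]; exact ⟨hqr, hqx⟩

/-- A `q`-free element of `A` whose `q`-extension is in `A` gives credit. -/
theorem credit_of_mem_mem (hq : BadEdge U F c0 c1 q s) {d : Finset α} (hd : d ∈ omegaA F c0 c1)
    (hqd : q ∉ d) (hdq : insert q d ∈ omegaA F c0 c1) : False :=
  badEdge_not_mem_qEdges hq (mem_qEdges.2 ⟨hd, hqd, hdq⟩)

/-- A `q`-free element of `C` whose `q`-extension is in `C` gives credit. -/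
theorem credit_of_mem_mem_C (hq : BadEdge U F c0 c1 q s) {d : Finset α} (hd : d ∈ omegaC U F c1)
    (hqd : q ∉ d) (hdq : insert q d ∈ omegaC U F c1) : False :=
  badEdge_not_mem_qEdges_omegaC hq (mem_qEdges.2 ⟨hd, hqd, hdq⟩)

/-- **Position `x = s`.** -/
theorem touch_lower_eq_false (hq : BadEdge U F c0 c1 q s) (hqr : q ≠ r)
    (hs0 : c0 s = c1 s) (hu0 : c0 (insert q s) = c1 (insert q s))
    (hrA : ∀ d ∈ qEdges r (omegaA F c0 c1), d = ∅) (hrU : r ∈ U)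
    (hrC : ∀ d, d ∉ qEdges r (omegaC U F c1))
    (hrs : r ∉ s) (hvs : insert r s ∈ F)
    (hx' : x' ∈ F) (hrx' : r ∉ x') (hvx' : insert r x' ∈ F) (hopp : c1 x' ≠ c1 s)
    (hnd' : NonDeg q s r x') : False := by
  have hsF := hq.2.1
  have hqs := hq.2.2.1
  have huF := hq.2.2.2.1
  have hexc := hq.2.2.2.2.1
  have h1 : c1 s ≠ c1 (insert q s) := fun h => hexc (hu0.trans h.symm)
  by_cases hc : c1 (insert r s) = c1 (insert q s)
  · have := one_le_omegaCredit_of_sdiff_eq_singleton (U := U) hsF hs0 huF hvs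
      (hu0.trans hc.symm) (insert_sdiff_insert_eq_singleton hqr hqs)
    have h0 := hq.2.2.2.2.2
    omega
  · have hcs : c1 (insert r s) = c1 s := bool_eq_of_ne_of_ne hc h1
    have hqx' : q ∉ x' := fun h =>
      badTwo_not_mem_of_notMem hq h1 hqr hrU hrC hx' hrx' hvx' hnd' h hrs
    have hsub := badTwo_subset hq h1 hqr hrA hx' hrx' hvx' hqx' hrs
    have hcx' : c1 (insert r x') = c1 x' := (edge_c1_eq_of_notMem hq hqr hx' hvx' hnd' hqx').symm
    have hcu : c1 (insert r x') = c1 (insert q s) := by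
      rw [hcx']; exact bool_eq_of_ne_of_ne hopp (Ne.symm h1)
    have hvss : insert r s ≠ s := fun h => hrs (h ▸ mem_insert_self r s)
    have heq : s ⊔ insert r s = s ⊔ insert r x' := by
      rw [sup_insert_eq_insert_of_subset (subset_refl s), sup_insert_eq_insert_of_subset hsub]
    exact badEdge_not_mem_qEdges_omegaC hq (qEdge_of_cojoin hq.1 hsF hqs huF hvs hvss hcs hvx'
      hnd'.2.2.2 hcu (notMem_insert_of_ne_of_notMem hqr hqx') heq)

/-- `a ≠ b` gives `a = !b`. -/
theorem bool_eq_not_of_ne (a b : Bool) (h : a ≠ b) : a = !b := by revert a b; decide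

/-- `a ≠ !b` gives `a = b`. -/
theorem bool_eq_of_ne_not (a b : Bool) (h : a ≠ !b) : a = b := by revert a b; decide

/-- **Position `x + r = s`.** -/
theorem touch_upper_eq_false (hq : BadEdge U F c0 c1 q s) (hqr : q ≠ r)
    (hs0 : c0 s = c1 s) (hu0 : c0 (insert q s) = c1 (insert q s))
    (hrA : ∀ d ∈ qEdges r (omegaA F c0 c1), d = ∅)
    (hx : x ∈ F) (hrx : r ∉ x) (hxs : insert r x = s) (hKx : c0 (insert r x) = c1 x ∨ x = ∅)
    (hx' : x' ∈ F) (hrx' : r ∉ x') (hvx' : insert r x' ∈ F)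
    (hKx' : c0 (insert r x') = c1 x' ∨ x' = ∅) (hopp : c1 x' ≠ c1 x)
    (hnd' : NonDeg q s r x') : False := by
  have hsF := hq.2.1
  have hqs := hq.2.2.1
  have huF := hq.2.2.2.1
  have hexc := hq.2.2.2.2.1
  have h0 : c0 s ≠ c0 (insert q s) := fun h => hexc (h.symm.trans hs0)
  have hcu : c0 (insert q s) = !c0 s := bool_eq_not_of_ne _ _ (Ne.symm h0)
  have hrs : r ∈ s := hxs ▸ mem_insert_self r x
  have hqx : q ∉ x := fun h => hqs (hxs ▸ mem_insert_of_mem h)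
  have hxs' : x ≠ s := fun h => hrx (h ▸ hrs)
  have hxsub : x ⊆ s := hxs ▸ subset_insert r x
  have hxer : x = s.erase r := by rw [← hxs, erase_insert hrx]
  have hcx'v : c1 x' = !c1 x := bool_eq_not_of_ne _ _ hopp
  -- the lower end `x` is in `A` when `c0 x = c0 s`
  have hxA : c0 x = c0 s → x ∈ omegaA F c0 c1 := fun h => by
    have := inf_mem_omegaA (c1 := c1) (Ne.symm hxs') hsF hx h.symm
    rwa [inf_eq_right.2 hxsub] at this
  -- `x = ∅` (so `s = {r}`) with `c1 x = !c0 s`: the `q`-edge `(s, s + q)`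
  have hempty : x = ∅ → c1 x = !c0 s → False := by
    intro hx0 hcx
    have hsr : s = {r} := by rw [← hxs, hx0]; rfl
    have hsx' : s \ x' = s := by
      rw [Finset.sdiff_eq_self_iff_disjoint, hsr, disjoint_singleton_left]; exact hrx'
    have hc : c1 x' = c0 s := by rw [hcx'v, hcx, Bool.not_not]
    have hsA : s ∈ omegaA F c0 c1 := by
      have := sdiff_mem_omegaA (c0 := c0) hsF hx' hc.symm
      rwa [hsx'] at this
    have huA : insert q s ∈ omegaA F c0 c1 := by
      have hc2 : c0 (insert q s) = c1 x := by rw [hcu, hcx]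
      have := sdiff_mem_omegaA (c0 := c0) (c1 := c1) huF hx hc2
      rwa [hx0, sdiff_empty] at this
    exact credit_of_mem_mem hq hsA hqs huA
  -- `c1 x ≠ c0 s` forces `x = ∅`
  have hxK : c1 x ≠ c0 s → x = ∅ := by
    intro hne
    rcases hKx with hK | hK
    · exact absurd (by rw [← hK, hxs]) hne
    · exact hK
  by_cases hqx' : q ∈ x'
  · have hx'ne : x' ≠ ∅ := fun h => by rw [h] at hqx'; exact notMem_empty q hqx'
    have hK' : c0 (insert r x') = c1 x' := hKx'.resolve_right hx'ne
    have hsub := badTwo_subset_insert hq h0 hrA hx' hrx' hvx' hqx' hrs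
    have hcx' : c0 x' = c1 x' := (edge_c0_eq_of_mem hq hx' hvx' hnd' hqx').trans hK'
    have hxsub' : x ⊆ x' := by
      intro z hz
      rw [hxer, mem_erase] at hz
      rcases mem_insert.1 (hsub hz.2) with h | h
      · exact absurd h hz.1
      · exact h
    have hux' : insert q s ⊓ x' = insert q x := by
      ext z
      simp only [inf_eq_inter, mem_inter, mem_insert]
      constructor
      · rintro ⟨rfl | hzs, hzx'⟩
        · exact Or.inl rfl
        · right; rw [hxer, mem_erase]; exact ⟨fun h => hrx' (h ▸ hzx'), hzs⟩
      · rintro (rfl | hzx)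
        · exact ⟨Or.inl rfl, hqx'⟩
        · exact ⟨Or.inr (hxsub hzx), hxsub' hzx⟩
    by_cases hcx : c1 x = c0 s
    · have hc0x' : c0 x' = c0 (insert q s) := by rw [hcx', hcx'v, hcx, hcu]
      have hup : insert q x ∈ omegaA F c0 c1 := by
        rw [← hux']
        exact inf_mem_omegaA (Ne.symm hnd'.2.1) huF hx' hc0x'.symm
      have hlow : x ∈ omegaA F c0 c1 := by
        rcases Bool.eq_or_eq_not (c0 x) (c0 s) with h | h
        · exact hxA h
        · have hxx' : x ≠ x' := fun hh => hqx (hh ▸ hqx')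
          have h' : c0 x = c0 x' := by rw [h, hcx', hcx'v, hcx]
          have := inf_mem_omegaA (c1 := c1) hxx' hx hx' h'
          rwa [inf_eq_left.2 hxsub'] at this
      exact credit_of_mem_mem hq hlow hqx hup
    · exact hempty (hxK hcx) (bool_eq_not_of_ne _ _ hcx)
  · have hdis := badTwo_inter_empty hq h0 hrA hx' hrx' hvx' hnd' hqx' hrs
    have hcx' : c1 (insert r x') = c1 x' := (edge_c1_eq_of_notMem hq hqr hx' hvx' hnd' hqx').symm
    have hqv' : q ∉ insert r x' := notMem_insert_of_ne_of_notMem hqr hqx'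
    have hux' : insert q s \ insert r x' = insert q x := by
      rw [hxer, ← sdiff_insert_eq_erase_of_disjoint hdis]
      exact insert_sdiff_of_notMem' hqv' s
    by_cases hcx : c1 x = c0 s
    · have hc1v : c1 (insert r x') = c0 (insert q s) := by rw [hcx', hcx'v, hcx, hcu]
      have hup : insert q x ∈ omegaA F c0 c1 := by
        rw [← hux']
        exact sdiff_mem_omegaA huF hvx' hc1v.symm
      have hlow : x ∈ omegaA F c0 c1 := by
        rcases Bool.eq_or_eq_not (c0 x) (c0 s) with h | h
        · exact hxA h
        · have h' : c0 x = c1 x' := by rw [h, hcx'v, hcx]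
          have := sdiff_mem_omegaA (c0 := c0) hx hx' h'
          have hxx' : x \ x' = x := by
            rw [Finset.sdiff_eq_self_iff_disjoint, disjoint_left]
            intro z hz hz'
            have : z ∈ x' ⊓ s := by
              simp only [inf_eq_inter, mem_inter]; exact ⟨hz', hxsub hz⟩
            rw [hdis] at this
            exact notMem_empty z this
          rwa [hxx'] at this
      exact credit_of_mem_mem hq hlow hqx hup
    · exact hempty (hxK hcx) (bool_eq_not_of_ne _ _ hcx)

/-- `insert q (U \ (s + q + r)) = U \ (s + r)` for `q ∈ U`, `q ∉ s`, `q ≠ r`. -/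
theorem insert_sdiff_insert_insert (hqU : q ∈ U) (hqs : q ∉ s) (hqr : q ≠ r) :
    insert q (U \ insert r (insert q s)) = U \ insert r s := by
  ext z
  simp only [mem_insert, mem_sdiff, not_or]
  constructor
  · rintro (rfl | ⟨hzU, hzr, -, hzs⟩)
    · exact ⟨hqU, hqr, hqs⟩
    · exact ⟨hzU, hzr, hzs⟩
  · rintro ⟨hzU, hzr, hzs⟩
    by_cases hzq : z = q
    · exact Or.inl hzq
    · exact Or.inr ⟨hzU, hzr, hzq, hzs⟩

/-- **Position `x = s + q`.** -/
theorem touch_lower_eq_upper_false (hq : BadEdge U F c0 c1 q s) (hqr : q ≠ r)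
    (hu0 : c0 (insert q s) = c1 (insert q s))
    (hrA : ∀ d ∈ qEdges r (omegaA F c0 c1), d = ∅) (hrU : r ∈ U)
    (hrC : ∀ d, d ∉ qEdges r (omegaC U F c1))
    (hru : r ∉ insert q s) (hvx : insert r (insert q s) ∈ F)
    (hx' : x' ∈ F) (hrx' : r ∉ x') (hvx' : insert r x' ∈ F) (hopp : c1 x' ≠ c1 (insert q s))
    (hnd' : NonDeg q s r x') : False := by
  have hsF := hq.2.1
  have hqs := hq.2.2.1
  have huF := hq.2.2.2.1
  have hexc := hq.2.2.2.2.1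
  have h1 : c1 s ≠ c1 (insert q s) := fun h => hexc (hu0.trans h.symm)
  have hrs : r ∉ s := fun h => hru (mem_insert_of_mem h)
  have hqx' : q ∉ x' := fun h =>
    badTwo_not_mem_of_notMem hq h1 hqr hrU hrC hx' hrx' hvx' hnd' h hrs
  have hsub := badTwo_subset hq h1 hqr hrA hx' hrx' hvx' hqx' hrs
  have hcx' : c1 (insert r x') = c1 x' := (edge_c1_eq_of_notMem hq hqr hx' hvx' hnd' hqx').symm
  have hcs : c1 s = c1 x' := bool_eq_of_ne_of_ne h1 hopp
  -- the lower end `U \ (s + q + r)` is in `C`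
  have hsubv : insert q s ⊆ insert r (insert q s) := subset_insert r _
  have hvne : insert q s ≠ insert r (insert q s) := fun h => hru (h ▸ mem_insert_self r _)
  have hlow : U \ insert r (insert q s) ∈ omegaC U F c1 := by
    by_cases hc : c1 (insert q s) = c1 (insert r (insert q s))
    · have := sdiff_sup_mem_omegaC (U := U) hvne huF hvx hc
      rwa [sup_eq_union, union_eq_right.2 hsubv] at this
    · have hc' : c1 (insert r (insert q s)) = c1 x' := bool_eq_of_ne_of_ne (Ne.symm hc) hopp
      have hx'sub : x' ⊆ insert r (insert q s) :=
        subset_trans hsub (subset_trans (subset_insert q s) (subset_insert r _))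
      have hne : insert r (insert q s) ≠ x' := fun h => hqx' (h ▸ mem_insert_of_mem (mem_insert_self q s))
      have := sdiff_sup_mem_omegaC (U := U) hne hvx hx' hc'
      rwa [sup_eq_union, union_eq_left.2 hx'sub] at this
  -- the upper end `U \ (s + r)` is in `C`
  have hup : insert q (U \ insert r (insert q s)) ∈ omegaC U F c1 := by
    rw [insert_sdiff_insert_insert hq.1 hqs hqr]
    have hne : s ≠ insert r x' := Ne.symm hnd'.2.2.1
    have := sdiff_sup_mem_omegaC (U := U) hne hsF hvx' (hcs.trans hcx'.symm)
    rwa [sup_insert_eq_insert_of_subset hsub] at this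
  have hqL : q ∉ U \ insert r (insert q s) := by
    simp only [mem_sdiff, mem_insert, true_or, or_true, not_true_eq_false, and_false,
      not_false_eq_true]
  exact credit_of_mem_mem_C hq hlow hqL hup

/-- **Position `x + r = s + q`.** -/
theorem touch_upper_eq_upper_false (hq : BadEdge U F c0 c1 q s) (hqr : q ≠ r)
    (hs0 : c0 s = c1 s) (hu0 : c0 (insert q s) = c1 (insert q s))
    (hrA : ∀ d ∈ qEdges r (omegaA F c0 c1), d = ∅)
    (hx : x ∈ F) (hrx : r ∉ x) (hxu : insert r x = insert q s)
    (hKx : c0 (insert r x) = c1 x ∨ x = ∅) (hxx' : x ≠ x')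
    (hx' : x' ∈ F) (hrx' : r ∉ x') (hvx' : insert r x' ∈ F)
    (hKx' : c0 (insert r x') = c1 x' ∨ x' = ∅) (hopp : c1 x' ≠ c1 x)
    (hnd' : NonDeg q s r x') : False := by
  have hsF := hq.2.1
  have hqs := hq.2.2.1
  have huF := hq.2.2.2.1
  have hexc := hq.2.2.2.2.1
  have h0 : c0 s ≠ c0 (insert q s) := fun h => hexc (h.symm.trans hs0)
  have hru : r ∈ insert q s := hxu ▸ mem_insert_self r x
  have hrs : r ∈ s := by
    rcases mem_insert.1 hru with h | h
    · exact absurd h.symm hqr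
    · exact h
  have hqx : q ∈ x := by
    have : q ∈ insert r x := hxu ▸ mem_insert_self q s
    rcases mem_insert.1 this with h | h
    · exact absurd h hqr
    · exact h
  have hxne : x ≠ ∅ := fun h => by rw [h] at hqx; exact notMem_empty q hqx
  have hKxu : c0 (insert q s) = c1 x := by rw [← hxu]; exact hKx.resolve_right hxne
  have hxer : x = insert q (s.erase r) := by
    rw [← erase_insert_of_ne hqr, ← hxu, erase_insert hrx]
  have hxsub : x ⊆ insert q s := hxu ▸ subset_insert r x
  have hxu' : x ≠ insert q s := fun h => hrx (h ▸ hru)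
  have hxs : x ≠ s := fun h => hqs (h ▸ hqx)
  -- `c1 x' = c0 s`
  have hcx' : c1 x' = c0 s := by
    rw [bool_eq_not_of_ne _ _ hopp, ← hKxu]
    rcases Bool.eq_or_eq_not (c0 (insert q s)) (c0 s) with h | h
    · exact absurd h.symm h0
    · rw [h, Bool.not_not]
  have hqser : q ∉ s.erase r := fun h => hqs (mem_of_mem_erase h)
  -- the upper end `x` is in `A`
  have hupA : (c0 x = c0 (insert q s)) ∨ (c0 x = c0 s) := by
    rcases Bool.eq_or_eq_not (c0 x) (c0 s) with h | h
    · exact Or.inr h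
    · left; rw [h, bool_eq_not_of_ne _ _ (Ne.symm h0)]
  have hxA_u : c0 x = c0 (insert q s) → x ∈ omegaA F c0 c1 := fun h => by
    have := inf_mem_omegaA (c1 := c1) hxu' hx huF h
    rwa [inf_eq_left.2 hxsub] at this
  by_cases hqx' : q ∈ x'
  · have hx'ne : x' ≠ ∅ := fun h => by rw [h] at hqx'; exact notMem_empty q hqx'
    have hK' : c0 (insert r x') = c1 x' := hKx'.resolve_right hx'ne
    have hsub := badTwo_subset_insert hq h0 hrA hx' hrx' hvx' hqx' hrs
    have hc0x' : c0 x' = c0 s := (edge_c0_eq_of_mem hq hx' hvx' hnd' hqx').trans (hK'.trans hcx')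
    have hlow : s.erase r ∈ omegaA F c0 c1 := by
      have := inf_mem_omegaA (c1 := c1) (Ne.symm hnd'.1) hsF hx' hc0x'.symm
      rwa [inf_insert_eq_erase_of_subset hrx' hsub] at this
    have hxsub' : x ⊆ x' := by
      rw [hxer]
      intro z hz
      rcases mem_insert.1 hz with rfl | hz
      · exact hqx'
      · rw [mem_erase] at hz
        rcases mem_insert.1 (hsub hz.2) with h | h
        · exact absurd h hz.1
        · exact h
    have hup : x ∈ omegaA F c0 c1 := by
      rcases hupA with h | h
      · exact hxA_u h
      · have := inf_mem_omegaA (c1 := c1) hxx' hx hx' (h.trans hc0x'.symm)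
        rwa [inf_eq_left.2 hxsub'] at this
    exact credit_of_mem_mem hq hlow hqser (hxer ▸ hup)
  · have hdis := badTwo_inter_empty hq h0 hrA hx' hrx' hvx' hnd' hqx' hrs
    have hcv' : c1 (insert r x') = c1 x' := (edge_c1_eq_of_notMem hq hqr hx' hvx' hnd' hqx').symm
    have hlow : s.erase r ∈ omegaA F c0 c1 := by
      have hc : c0 s = c1 (insert r x') := by rw [hcv', hcx']
      have := sdiff_mem_omegaA (c0 := c0) (c1 := c1) hsF hvx' hc
      rwa [sdiff_insert_eq_erase_of_disjoint hdis] at this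
    have hup : x ∈ omegaA F c0 c1 := by
      rcases hupA with h | h
      · exact hxA_u h
      · have := sdiff_mem_omegaA (c0 := c0) hx hx' (h.trans hcx'.symm)
        have hxx' : x \ x' = x := by
          rw [Finset.sdiff_eq_self_iff_disjoint, disjoint_left]
          intro z hz hz'
          rw [hxer] at hz
          rcases mem_insert.1 hz with rfl | hz
          · exact hqx' hz'
          · have : z ∈ x' ⊓ s := by
              simp only [inf_eq_inter, mem_inter]; exact ⟨hz', mem_of_mem_erase hz⟩
            rw [hdis] at this
            exact notMem_empty z this
        rwa [hxx'] at this
    exact credit_of_mem_mem hq hlow hqser (hxer ▸ hup)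

end Touch

end PercRepro.MSTight
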